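import Summits.QuantumAdvantage.QuantumAdvantage.Theorems.CharDialFormJuntaE

/-! # CharDialFormJunta — part 6/6 (mechanical split for landing of `CharDialFormJunta`; content verbatim; scopes re-opened with their variables) -/

noncomputable section
open Finset

namespace Summit.QuantumAdvantage.AdviceFreeQNC0.WindowCounter
open Summit.QuantumAdvantage.AdviceFreeQNC0

section BlockProduct2
variable (p : ℕ) [Fact p.Prime] {n : ℕ}
variable (y : Fin (n + 1) → (Fin n → Bool) → Bool) (c : ℕ) (J : Fin (n + 1) → Finset (Fin n))

/-! ### averaging identity and the final bound -/

/-- CharDialFormJunta helper `sum_msum_avg` (decomp-qadv land package; see the module docstring). -/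
theorem sum_msum_avg (Q : (Fin n → Bool) → ℂ) : ∀ (m : ℕ) (k : Fin m → ℕ), (∀ j, k j + 3 ≤ n) →
    ∑ cv : Fin m → Fin 3, ∑ u, msum Q m k (fun j => (cv j).val) u = 8 ^ m * ∑ u, Q u := by
  intro m; induction m with
  | zero => intro k _; simp [msum_zero]
  | succ m ih =>
    intro k hk
    rw [← (Fin.consEquiv fun _ : Fin (m + 1) => Fin 3).sum_comp, Fintype.sum_prod_type]
    simp only [Fin.consEquiv, Equiv.coe_fn_mk]
    simp only [msum_succ, Fin.cons_zero]
    calc ∑ c₀ : Fin 3, ∑ cv : Fin m → Fin 3, ∑ u, ∑ X ∈ Cl c₀.val, msum Q m (Fin.tail k) (fun j => (cv j).val) (setBlk (k 0) X u)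
        = ∑ cv : Fin m → Fin 3, ∑ u, ∑ c₀ : Fin 3, ∑ X ∈ Cl c₀.val,
            msum Q m (Fin.tail k) (fun j => (cv j).val) (setBlk (k 0) X u) := by
          rw [sum_comm]; exact sum_congr rfl fun cv _ => sum_comm
      _ = ∑ cv : Fin m → Fin 3, ∑ u, ∑ X : Fin 3 → Bool, msum Q m (Fin.tail k) (fun j => (cv j).val) (setBlk (k 0) X u) :=
          sum_congr rfl fun cv _ => sum_congr rfl fun u _ => sum_Cl _
      _ = ∑ cv : Fin m → Fin 3, 8 * ∑ u, msum Q m (Fin.tail k) (fun j => (cv j).val) u := by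
          refine sum_congr rfl fun cv _ => ?_
          rw [sum_comm]; exact sum_setBlk (k 0) (hk 0) _
      _ = 8 ^ (m + 1) * ∑ u, Q u := by rw [← mul_sum, ih (Fin.tail k) (fun j => hk j.succ), pow_succ]; ring

/-- **THE BLOCK PRODUCT THEOREM.**  `m` pairwise separated, pairwise non-interacting GOOD blocks ⟹
`‖Σ_u (∏_g sgn fires_g u) ψ_p(t⟨a,u⟩)‖ ≤ 2ⁿ κ_F^m`. -/
theorem norm_sum_Qf_le (hp : 5 ≤ p) (hJ : ∀ g u v, (∀ i ∈ J g, u i = v i) → y g u = y g v) (a : Fin n → ZMod p)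
    {t : ZMod p} (ht : t ≠ 0) (m : ℕ) (k : Fin m → ℕ) (hk : ∀ j, k j + 3 ≤ n)
    (hsep : ∀ j j', j ≠ j' → k j + 3 ≤ k j' ∨ k j' + 3 ≤ k j)
    (hni : ∀ g j j', j ≠ j' → touch J g (k j) = true → ¬ (touch J g (k j') = true)) (hgd : ∀ j, aExt p a (k j) ≠ 0) :
    ‖∑ u, Qf p y c a t u‖ ≤ 2 ^ n * kappaF p ^ m := by
  have havg := sum_msum_avg (Qf p y c a t) m k hk
  have h8 : (8 : ℂ) ^ m ≠ 0 := pow_ne_zero _ (by norm_num)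
  have hS : ∑ u, Qf p y c a t u = (∑ cv : Fin m → Fin 3, ∑ u, msum (Qf p y c a t) m k (fun j => (cv j).val) u) / 8 ^ m := by
    rw [havg]; field_simp
  have hbd : ‖∑ cv : Fin m → Fin 3, ∑ u, msum (Qf p y c a t) m k (fun j => (cv j).val) u‖ ≤ 2 ^ n * (6 + betaF p) ^ m := by
    calc _ ≤ ∑ cv : Fin m → Fin 3, ∑ u : Fin n → Bool, ∏ j, bcl p a (k j) (cv j).val := by
          refine (norm_sum_le _ _).trans (sum_le_sum fun cv _ => (norm_sum_le _ _).trans (sum_le_sum fun u _ => ?_))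
          exact msum_bound p y c J hp hJ a ht m k _ hk hsep hni hgd (fun j => (cv j).isLt) u
      _ = 2 ^ n * ∑ cv : Fin m → Fin 3, ∏ j, bcl p a (k j) (cv j).val := by
          rw [mul_sum]; refine sum_congr rfl fun cv _ => ?_
          rw [sum_const, card_univ, Fintype.card_fun, Fintype.card_bool, Fintype.card_fin, nsmul_eq_mul]; push_cast; ring
      _ = 2 ^ n * ∏ j : Fin m, ∑ c₀ : Fin 3, bcl p a (k j) c₀.val := by
          rw [Finset.prod_univ_sum (fun _ => (univ : Finset (Fin 3))) (fun j c₀ => bcl p a (k j) c₀.val),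
            Fintype.piFinset_univ]
      _ = 2 ^ n * (6 + betaF p) ^ m := by
          rw [prod_congr rfl fun j _ => sum_bcl p a (k j), prod_const, card_univ, Fintype.card_fin]
  have h8n : ‖(8 : ℂ) ^ m‖ = 8 ^ m := by simp
  rw [hS, norm_div, h8n, div_le_iff₀ (by positivity), kappaF, div_pow, mul_div_assoc', div_mul_cancel₀ _ (by positivity)]
  exact hbd

end BlockProduct2

/-! ## §I″ BLOCK SELECTION for `log`-juntas in dense directions, and `FormJuntaBias` as a THEOREM

From the good positions (`a_k ≠ 0`, `k+3 ≤ n`) keep one residue class mod 3 (pairwise separated blocks); in the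
interaction graph («some cut touches both») the degree sum is `≤ Σ_g τ_g² ≤ (n+1)(L+1)²` (`τ_g ≤ L+1` blocks touched by
cut `g`), so (Markov + greedy) there are `m ≥ c·n/L²` pairwise non-interacting good blocks; with the block product theorem
and `[WIN] = (1 − F)/2` this proves the form-twisted bias bound for ARBITRARY-position `log₂ n`-juntas (`formJunta_small`). -/

section BlockSelect

variable {n : ℕ}

/-- greedy independent sets: maximum degree `D` ⟹ an independent set of size `≥ |S|/(D+1)`. -/
theorem exists_indep {α : Type*} [DecidableEq α] (adj : α → α → Bool) (hsym : ∀ a b, adj a b = true → adj b a = true)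
    (D : ℕ) : ∀ (N : ℕ) (S : Finset α), S.card ≤ N → (∀ a ∈ S, (S.filter fun b => b ≠ a ∧ adj a b = true).card ≤ D) →
    ∃ I : Finset α, I ⊆ S ∧ (∀ a ∈ I, ∀ b ∈ I, a ≠ b → ¬ (adj a b = true)) ∧ S.card ≤ (D + 1) * I.card := by
  intro N; induction N with
  | zero =>
    intro S hS _
    exact ⟨∅, empty_subset _, by simp, by simp [Nat.le_zero.1 hS]⟩
  | succ N ih =>
    intro S hS hdeg
    rcases S.eq_empty_or_nonempty with hSe | ⟨a, ha⟩
    · exact ⟨∅, empty_subset _, by simp, by simp [hSe]⟩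
    · have hsplit := Finset.card_filter_add_card_filter_not (s := S) (fun b => b ≠ a ∧ ¬ (adj a b = true))
      have hrest : (S.filter (fun b => ¬ (b ≠ a ∧ ¬ (adj a b = true)))).card ≤ D + 1 := by
        calc _ ≤ (insert a (S.filter fun b => b ≠ a ∧ adj a b = true)).card := card_le_card (by
              intro b hb; rw [mem_filter] at hb; rw [mem_insert, mem_filter]
              by_cases hba : b = a
              · exact Or.inl hba
              · right; refine ⟨hb.1, hba, ?_⟩; by_contra h; exact hb.2 ⟨hba, h⟩)
          _ ≤ (S.filter fun b => b ≠ a ∧ adj a b = true).card + 1 := card_insert_le _ _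
          _ ≤ D + 1 := by have := hdeg a ha; omega
      have hpos : 1 ≤ (S.filter (fun b => ¬ (b ≠ a ∧ ¬ (adj a b = true)))).card :=
        card_pos.2 ⟨a, by rw [mem_filter]; exact ⟨ha, fun h => h.1 rfl⟩⟩
      have hS'card : (S.filter (fun b => b ≠ a ∧ ¬ (adj a b = true))).card ≤ N := by omega
      have hdeg' : ∀ b ∈ S.filter (fun b => b ≠ a ∧ ¬ (adj a b = true)),
          ((S.filter (fun b => b ≠ a ∧ ¬ (adj a b = true))).filter fun b' => b' ≠ b ∧ adj b b' = true).card ≤ D :=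
        fun b hb => le_trans (card_le_card (filter_subset_filter _ (filter_subset _ _))) (hdeg b (mem_filter.1 hb).1)
      obtain ⟨I', hI'S', hind', hcard'⟩ := ih _ hS'card hdeg'
      have haI' : a ∉ I' := fun h => (mem_filter.1 (hI'S' h)).2.1 rfl
      refine ⟨insert a I', ?_, ?_, ?_⟩
      · intro b hb
        rcases mem_insert.1 hb with hba | hb
        · rw [hba]; exact ha
        · exact (mem_filter.1 (hI'S' hb)).1
      · intro x hx x' hx' hne hadj
        rcases mem_insert.1 hx with hxa | hxI <;> rcases mem_insert.1 hx' with hx'a | hx'I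
        · exact hne (hxa.trans hx'a.symm)
        · rw [hxa] at hadj; exact (mem_filter.1 (hI'S' hx'I)).2.2 hadj
        · rw [hx'a] at hadj; exact (mem_filter.1 (hI'S' hxI)).2.2 (hsym _ _ hadj)
        · exact hind' x hxI x' hx'I hne hadj
      · rw [card_insert_of_notMem haI']
        calc S.card = (S.filter (fun b => b ≠ a ∧ ¬ (adj a b = true))).card +
              (S.filter (fun b => ¬ (b ≠ a ∧ ¬ (adj a b = true)))).card := hsplit.symm
          _ ≤ (D + 1) * I'.card + (D + 1) := add_le_add hcard' hrest
          _ = (D + 1) * (I'.card + 1) := by ring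

/-- two blocks INTERACT: some cut touches both. -/
def adjT (J : Fin (n + 1) → Finset (Fin n)) (k k' : ℕ) : Bool :=
  decide (∃ g : Fin (n + 1), touch J g k = true ∧ touch J g k' = true)

/-- CharDialFormJunta helper `adjT_symm` (decomp-qadv land package; see the module docstring). -/
theorem adjT_symm (J : Fin (n + 1) → Finset (Fin n)) (k k' : ℕ) (h : adjT J k k' = true) : adjT J k' k = true := by
  unfold adjT at h ⊢; rw [decide_eq_true_eq] at h ⊢
  obtain ⟨g, h1, h2⟩ := h; exact ⟨g, h2, h1⟩

/-- a cut touches at most `L + 1` pairwise separated blocks. -/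
theorem card_touch_le (J : Fin (n + 1) → Finset (Fin n)) {L : ℕ} (hJc : ∀ g, (J g).card ≤ L) (T : Finset ℕ)
    (hsep : ∀ k ∈ T, ∀ k' ∈ T, k ≠ k' → k + 3 ≤ k' ∨ k' + 3 ≤ k) (g : Fin (n + 1)) :
    (T.filter fun k => touch J g k = true).card ≤ L + 1 := by
  classical
  have h1 : (T.filter fun k => ∃ i ∈ J g, k ≤ i.val ∧ i.val < k + 3).card ≤ L := by
    calc _ ≤ ((J g).biUnion fun i => T.filter fun k => k ≤ i.val ∧ i.val < k + 3).card := card_le_card (by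
            intro k hk; rw [mem_filter] at hk; rw [mem_biUnion]
            obtain ⟨i, hi, h⟩ := hk.2; exact ⟨i, hi, mem_filter.2 ⟨hk.1, h⟩⟩)
      _ ≤ ∑ i ∈ J g, (T.filter fun k => k ≤ i.val ∧ i.val < k + 3).card := card_biUnion_le
      _ ≤ ∑ i ∈ J g, 1 := sum_le_sum fun i _ => Finset.card_le_one.2 fun k hk k' hk' => by
          rw [mem_filter] at hk hk'
          by_contra hne
          rcases hsep k hk.1 k' hk'.1 hne with h | h <;> omega
      _ ≤ L := by rw [sum_const, smul_eq_mul, mul_one]; exact hJc g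
  have h2 : (T.filter fun k => g.val = k + 1 ∨ g.val = k + 2).card ≤ 1 := Finset.card_le_one.2 fun k hk k' hk' => by
    rw [mem_filter] at hk hk'
    by_contra hne
    rcases hsep k hk.1 k' hk'.1 hne with h | h <;> omega
  calc _ ≤ ((T.filter fun k => ∃ i ∈ J g, k ≤ i.val ∧ i.val < k + 3) ∪
        (T.filter fun k => g.val = k + 1 ∨ g.val = k + 2)).card := card_le_card (by
          intro k hk; rw [mem_filter] at hk; rw [mem_union, mem_filter, mem_filter]
          have h := hk.2; unfold touch at h; rw [decide_eq_true_eq] at h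
          rcases h with h | h
          · exact Or.inl ⟨hk.1, h⟩
          · exact Or.inr ⟨hk.1, h⟩)
    _ ≤ _ := (card_union_le _ _).trans (add_le_add h1 h2)

/-- **degree sum of the interaction graph**: `Σ_k deg k ≤ Σ_g τ_g² ≤ (n+1)(L+1)²`. -/
theorem sum_deg_le (J : Fin (n + 1) → Finset (Fin n)) {L : ℕ} (hJc : ∀ g, (J g).card ≤ L) (T : Finset ℕ)
    (hsep : ∀ k ∈ T, ∀ k' ∈ T, k ≠ k' → k + 3 ≤ k' ∨ k' + 3 ≤ k) :
    ∑ k ∈ T, (T.filter fun k' => k' ≠ k ∧ adjT J k k' = true).card ≤ (n + 1) * (L + 1) ^ 2 := by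
  classical
  set τ : Fin (n + 1) → ℕ := fun g => (T.filter fun k => touch J g k = true).card with hτ
  have hdeg : ∀ k ∈ T, (T.filter fun k' => k' ≠ k ∧ adjT J k k' = true).card ≤
      ∑ g ∈ univ.filter (fun g : Fin (n + 1) => touch J g k = true), τ g := fun k _ => by
    calc _ ≤ ((univ.filter fun g : Fin (n + 1) => touch J g k = true).biUnion
          fun g => T.filter fun k' => touch J g k' = true).card := card_le_card (by
            intro k' hk'; rw [mem_filter] at hk'; rw [mem_biUnion]
            have h := hk'.2.2; unfold adjT at h; rw [decide_eq_true_eq] at h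
            obtain ⟨g, hg1, hg2⟩ := h
            exact ⟨g, mem_filter.2 ⟨mem_univ _, hg1⟩, mem_filter.2 ⟨hk'.1, hg2⟩⟩)
      _ ≤ _ := card_biUnion_le
  calc _ ≤ ∑ k ∈ T, ∑ g ∈ univ.filter (fun g : Fin (n + 1) => touch J g k = true), τ g := sum_le_sum hdeg
    _ = ∑ k ∈ T, ∑ g : Fin (n + 1), if touch J g k = true then τ g else 0 :=
        sum_congr rfl fun k _ => sum_filter _ _
    _ = ∑ g : Fin (n + 1), ∑ k ∈ T, if touch J g k = true then τ g else 0 := sum_comm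
    _ = ∑ g : Fin (n + 1), τ g * τ g := sum_congr rfl fun g _ => by rw [← sum_filter, sum_const, smul_eq_mul]
    _ ≤ ∑ g : Fin (n + 1), (L + 1) * (L + 1) :=
        sum_le_sum fun g _ => Nat.mul_le_mul (card_touch_le J hJc T hsep g) (card_touch_le J hJc T hsep g)
    _ = (n + 1) * (L + 1) ^ 2 := by rw [sum_const, card_univ, Fintype.card_fin, smul_eq_mul]; ring

/-- **BLOCK SELECTION**: from pairwise separated candidate starts `T`, `m` pairwise NON-INTERACTING ones with
`|T|² ≤ 2m·(2(n+1)(L+1)² + |T|)`. -/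
theorem exists_blocks (J : Fin (n + 1) → Finset (Fin n)) {L : ℕ} (hJc : ∀ g, (J g).card ≤ L) (T : Finset ℕ)
    (hsep : ∀ k ∈ T, ∀ k' ∈ T, k ≠ k' → k + 3 ≤ k' ∨ k' + 3 ≤ k) :
    ∃ (m : ℕ) (k : Fin m → ℕ), (∀ j, k j ∈ T) ∧ (∀ j j', j ≠ j' → k j ≠ k j') ∧
      (∀ g j j', j ≠ j' → touch J g (k j) = true → ¬ (touch J g (k j') = true)) ∧
      T.card ^ 2 ≤ 2 * m * (2 * ((n + 1) * (L + 1) ^ 2) + T.card) := by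
  classical
  rcases Nat.eq_zero_or_pos T.card with hT0 | hTpos
  · exact ⟨0, Fin.elim0, fun j => j.elim0, fun j => j.elim0, fun _ j => j.elim0, by rw [hT0]; simp⟩
  set M := (n + 1) * (L + 1) ^ 2 with hM
  set deg : ℕ → ℕ := fun k => (T.filter fun k' => k' ≠ k ∧ adjT J k k' = true).card with hdegdef
  have hsum : ∑ k ∈ T, deg k ≤ M := sum_deg_le J hJc T hsep
  set D := 2 * M / T.card with hD
  set light := T.filter fun k => deg k ≤ D with hlight
  have hsplit := Finset.card_filter_add_card_filter_not (s := T) (fun k => deg k ≤ D)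
  -- Markov
  have hheavy : 2 * (T.filter fun k => ¬ deg k ≤ D).card < T.card := by
    have h1 : (T.filter fun k => ¬ deg k ≤ D).card * (D + 1) ≤ M := by
      calc _ = ∑ k ∈ T.filter (fun k => ¬ deg k ≤ D), (D + 1) := by rw [sum_const, smul_eq_mul]
        _ ≤ ∑ k ∈ T.filter (fun k => ¬ deg k ≤ D), deg k := sum_le_sum fun k hk => by
            have := (mem_filter.1 hk).2; omega
        _ ≤ ∑ k ∈ T, deg k := sum_le_sum_of_subset (filter_subset _ _)
        _ ≤ M := hsum
    have h2 : 2 * M < (D + 1) * T.card := by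
      have := Nat.lt_div_mul_add (a := 2 * M) hTpos
      rw [hD]; linarith
    have h4 : (D + 1) * (2 * (T.filter fun k => ¬ deg k ≤ D).card) < (D + 1) * T.card := by
      calc (D + 1) * (2 * (T.filter fun k => ¬ deg k ≤ D).card) = 2 * ((T.filter fun k => ¬ deg k ≤ D).card * (D + 1)) := by ring
        _ ≤ 2 * M := by omega
        _ < (D + 1) * T.card := h2
    exact Nat.lt_of_mul_lt_mul_left h4
  have hlight2 : T.card ≤ 2 * light.card := by
    have : light.card = (T.filter fun k => deg k ≤ D).card := by rw [hlight]
    omega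
  -- greedy on the light part
  have hdegL : ∀ k ∈ light, (light.filter fun k' => k' ≠ k ∧ adjT J k k' = true).card ≤ D := fun k hk =>
    le_trans (card_le_card (filter_subset_filter _ (filter_subset _ _))) (mem_filter.1 hk).2
  obtain ⟨I, hIl, hind, hIcard⟩ := exists_indep (adjT J) (adjT_symm J) D light.card light le_rfl hdegL
  have hIT : I ⊆ T := hIl.trans (filter_subset _ _)
  refine ⟨I.card, fun j => I.orderEmbOfFin rfl j, fun j => hIT (orderEmbOfFin_mem I rfl j),
    fun j j' h e => h ((I.orderEmbOfFin rfl).injective e), fun g j j' hjj h1 h2 => ?_, ?_⟩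
  · have hne : I.orderEmbOfFin rfl j ≠ I.orderEmbOfFin rfl j' := fun e => hjj ((I.orderEmbOfFin rfl).injective e)
    refine hind _ (orderEmbOfFin_mem I rfl j) _ (orderEmbOfFin_mem I rfl j') hne ?_
    unfold adjT; rw [decide_eq_true_eq]; exact ⟨g, h1, h2⟩
  · have hDT : D * T.card ≤ 2 * M := by rw [hD]; exact Nat.div_mul_le_self _ _
    calc T.card ^ 2 = T.card * T.card := sq _
      _ ≤ (2 * ((D + 1) * I.card)) * T.card := Nat.mul_le_mul_right _ (hlight2.trans (Nat.mul_le_mul_left _ hIcard))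
      _ = 2 * I.card * (D * T.card + T.card) := by ring
      _ ≤ 2 * I.card * (2 * M + T.card) := Nat.mul_le_mul_left _ (by omega)

end BlockSelect

section FormJunta

variable (p : ℕ) [Fact p.Prime] {n : ℕ}
set_option maxHeartbeats 400000 in
/-- **`FormJuntaBias` IS A THEOREM (p ≥ 5)**: for `log₂ n`-junta strategies reading bits ANYWHERE, dense directions `a`
and `t ≠ 0`, `‖Σ_u [WIN_y u] ψ_p(t⟨a,u⟩)‖ ≤ ε·2ⁿ` eventually, uniformly. -/
theorem formJunta_small (hp : 5 ≤ p) : ∀ ε : ℝ, 0 < ε → ∃ n₁ : ℕ, ∀ n ≥ n₁, ∀ (c : ℕ) (a : Fin n → ZMod p)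
    (y : Fin (n + 1) → (Fin n → Bool) → Bool),
      (∀ g, ∃ J : Finset (Fin n), J.card ≤ Nat.log 2 n ∧ ∀ u v : Fin n → Bool, (∀ i ∈ J, u i = v i) → y g u = y g v) →
      n ≤ 2 * (univ.filter fun i : Fin n => a i ≠ 0).card →
        ∀ t : ZMod p, t ≠ 0 → ‖formSum p a c y t‖ ≤ ε * 2 ^ n := by
  classical
  intro ε hε
  have hκ0 := kappaF_nonneg p
  have hκ1 := kappaF_lt_one p hp
  obtain ⟨q₀, hq₀⟩ := exists_pow_lt_of_lt_one hε hκ1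
  obtain ⟨N₀, hN₀⟩ := DWalk.const_mul_logPow_le' (4896 * q₀ + 1) 2
  refine ⟨max N₀ 16, fun n hn c a y hy hdense t ht => ?_⟩
  have hn16 : 16 ≤ n := le_trans (le_max_right _ _) hn
  have hlog : (4896 * q₀ + 1) * Nat.log 2 n ^ 2 ≤ n := hN₀ n (le_trans (le_max_left _ _) hn)
  have hℓ1 : 1 ≤ Nat.log 2 n := Nat.log_pos one_lt_two (by omega)
  choose J hJc hJ using hy
  -- candidate starts: good positions with room for a block
  set S₀ : Finset ℕ := (range n).filter fun k => k + 3 ≤ n ∧ aExt p a k ≠ 0 with hS₀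
  have hS₀card : (univ.filter fun i : Fin n => a i ≠ 0).card ≤ S₀.card + 2 := by
    have h1 : ((univ.filter fun i : Fin n => a i ≠ 0 ∧ i.val + 3 ≤ n).image fun i : Fin n => i.val) ⊆ S₀ := by
      intro k hk; rw [mem_image] at hk; obtain ⟨i, hi, rfl⟩ := hk; rw [mem_filter] at hi
      rw [hS₀, mem_filter, mem_range]; refine ⟨i.isLt, hi.2.2, ?_⟩
      unfold aExt; rw [dif_pos i.isLt]; exact hi.2.1
    have h2 : (univ.filter fun i : Fin n => ¬ (i.val + 3 ≤ n)).card ≤ 2 := by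
      calc _ ≤ (range 2).card := Finset.card_le_card_of_injOn (fun i : Fin n => n - 1 - i.val) (fun i hi => by
              have hi' : ¬ (i.val + 3 ≤ n) := by simpa using hi
              simp only [mem_coe, mem_range]; omega) (by
              intro i hi i' hi' hh
              have h3 : ¬ (i.val + 3 ≤ n) := by simpa using hi
              have h4 : ¬ (i'.val + 3 ≤ n) := by simpa using hi'
              ext; simp only at hh; omega)
        _ = 2 := card_range 2
    have h3 := card_le_card h1
    rw [card_image_of_injective _ Fin.val_injective] at h3
    calc (univ.filter fun i : Fin n => a i ≠ 0).card
        ≤ ((univ.filter fun i : Fin n => a i ≠ 0 ∧ i.val + 3 ≤ n) ∪ (univ.filter fun i : Fin n => ¬ (i.val + 3 ≤ n))).card :=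
          card_le_card (by
            intro i hi; rw [mem_filter] at hi; rw [mem_union, mem_filter, mem_filter]
            by_cases h : i.val + 3 ≤ n
            · exact Or.inl ⟨hi.1, hi.2, h⟩
            · exact Or.inr ⟨hi.1, h⟩)
      _ ≤ _ := card_union_le _ _
      _ ≤ S₀.card + 2 := add_le_add h3 h2
  -- one residue class mod 3: pairwise separated
  obtain ⟨r, -, hr⟩ := Finset.exists_le_card_fiber_of_mul_le_card_of_maps_to (s := S₀) (t := range 3) (f := fun k => k % 3)
    (fun k _ => mem_range.2 (Nat.mod_lt _ (by norm_num))) (by simp) (by rw [card_range]; exact Nat.mul_div_le _ 3)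
  set T := S₀.filter fun k => k % 3 = r with hTdef
  have hT3 : S₀.card ≤ 3 * T.card + 2 := by have := hr; omega
  have hTn : ∀ k ∈ T, k + 3 ≤ n := fun k hk => by
    have := (mem_filter.1 (mem_filter.1 hk).1).2; exact this.1
  have hTgd : ∀ k ∈ T, aExt p a k ≠ 0 := fun k hk => by
    have := (mem_filter.1 (mem_filter.1 hk).1).2; exact this.2
  have hTsep : ∀ k ∈ T, ∀ k' ∈ T, k ≠ k' → k + 3 ≤ k' ∨ k' + 3 ≤ k := fun k hk k' hk' hne => by
    have h1 := (mem_filter.1 hk).2; have h2 := (mem_filter.1 hk').2; omega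
  have hTle : T.card ≤ n :=
    (card_le_card (filter_subset _ _)).trans ((card_le_card (filter_subset _ _)).trans (card_range n).le)
  obtain ⟨m, k, hkT, hkinj, hni, hsize⟩ := exists_blocks J hJc T hTsep
  -- enough blocks
  have hm : q₀ ≤ m := by
    by_contra hlt; push Not at hlt
    have h12 : n ≤ 12 * T.card := by omega
    have hsz : T.card ^ 2 ≤ 2 * q₀ * (2 * ((n + 1) * (Nat.log 2 n + 1) ^ 2) + T.card) :=
      le_trans hsize (Nat.mul_le_mul_right _ (Nat.mul_le_mul_left _ hlt.le))
    have h1 : (Nat.log 2 n + 1) ^ 2 ≤ 4 * Nat.log 2 n ^ 2 := by nlinarith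
    have h2 : (n + 1) * (Nat.log 2 n + 1) ^ 2 ≤ (2 * n) * (4 * Nat.log 2 n ^ 2) := Nat.mul_le_mul (by omega) h1
    have h3 : T.card ≤ n * Nat.log 2 n ^ 2 := le_trans hTle (Nat.le_mul_of_pos_right _ (by positivity))
    have h4 : 2 * q₀ * (2 * ((n + 1) * (Nat.log 2 n + 1) ^ 2) + T.card) ≤ 34 * q₀ * (n * Nat.log 2 n ^ 2) := by
      nlinarith
    have h5 : n ^ 2 ≤ 144 * T.card ^ 2 := by nlinarith
    have h6 : n ^ 2 ≤ 4896 * q₀ * (n * Nat.log 2 n ^ 2) := by nlinarith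
    have h7 : n ≤ 4896 * q₀ * Nat.log 2 n ^ 2 := by
      have hn0 : 0 < n := by omega
      have : n * n ≤ (4896 * q₀ * Nat.log 2 n ^ 2) * n := by nlinarith
      exact Nat.le_of_mul_le_mul_right this hn0
    have h8 : 1 ≤ Nat.log 2 n ^ 2 := Nat.one_le_pow _ _ hℓ1
    nlinarith
  -- the two character sums
  have hkn : ∀ j, k j + 3 ≤ n := fun j => hTn _ (hkT j)
  have hksep : ∀ j j', j ≠ j' → k j + 3 ≤ k j' ∨ k j' + 3 ≤ k j := fun j j' h => hTsep _ (hkT j) _ (hkT j') (hkinj j j' h)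
  have hkgd : ∀ j, aExt p a (k j) ≠ 0 := fun j => hTgd _ (hkT j)
  have hQ := norm_sum_Qf_le p y c J hp hJ a ht m k hkn hksep hni hkgd
  have hQ0 := norm_sum_Qf_le p (fun _ _ => false) c J hp (fun _ _ _ _ => rfl) a ht m k hkn hksep hni hkgd
  have hplain : ∑ u, Qf p (fun _ _ => false) c a t u = ∑ u : Fin n → Bool, (ZMod.stdAddChar (t * linF p a u) : ℂ) :=
    sum_congr rfl fun u _ => by simp [Qf, fires]
  rw [hplain] at hQ0
  have e : ∀ u : Fin n → Bool, (if ringWinU c y u = true then (1 : ℂ) else 0) * (ZMod.stdAddChar (t * linF p a u) : ℂ) =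
      ((ZMod.stdAddChar (t * linF p a u) : ℂ) - Qf p y c a t u) / 2 := fun u => by
    rw [win_indicator]; unfold Qf; ring
  have hform : formSum p a c y t =
      ((∑ u : Fin n → Bool, (ZMod.stdAddChar (t * linF p a u) : ℂ)) - ∑ u, Qf p y c a t u) / 2 := by
    unfold formSum; rw [sum_congr rfl fun u _ => e u, ← sum_div, sum_sub_distrib]
  have hκm : kappaF p ^ m ≤ kappaF p ^ q₀ := pow_le_pow_of_le_one hκ0 hκ1.le hm
  have h2 : ‖(2 : ℂ)‖ = 2 := by simp
  have h2n : (0 : ℝ) ≤ 2 ^ n := by positivity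
  rw [hform, norm_div, h2]
  calc _ ≤ (‖∑ u : Fin n → Bool, (ZMod.stdAddChar (t * linF p a u) : ℂ)‖ + ‖∑ u, Qf p y c a t u‖) / 2 := by
        gcongr; exact norm_sub_le _ _
    _ ≤ (2 ^ n * kappaF p ^ m + 2 ^ n * kappaF p ^ m) / 2 := by gcongr
    _ = 2 ^ n * kappaF p ^ m := by ring
    _ ≤ 2 ^ n * kappaF p ^ q₀ := mul_le_mul_of_nonneg_left hκm h2n
    _ ≤ ε * 2 ^ n := by rw [mul_comm]; exact mul_le_mul_of_nonneg_right hq₀.le h2n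

end FormJunta

end Summit.QuantumAdvantage.AdviceFreeQNC0.WindowCounter
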